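import Literature.MathematicalPhysics.QuantumLattice.RepLieAlgebra
import HarnessLib

/-!
# The bare clover pseudoscalar density `P_x = −½ ∑ tr(F_{μν} F̃_{μν})` of lattice gauge theory

Topic `Literature/MathematicalPhysics/QuantumLattice` (definition request `defn-cloverPseudoscalar`,
wanted by route `DualityDefect` of `QuantumFields/YangMills`: items `CloverSelfDualSplit`,
`CloverParityRP`, …, which inline `P` via `let`).

With Lüscher's clover field tensor `C_{μν}(x) = flowedClover ρ 0 U x μ ν` (flow time `0`, i.e. the
link matrices are `V = ρ(U)`; `π_𝔤` of the average of the four plaquette loops in the `(μ, ν)` plane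
through `x`, [Luscher2010, §3.2 Fig. 1]) the tree already has the clover ACTION density
`flowedCloverEnergy ρ 0 x U = ∑_{μ<ν} Re tr(C_{μν}ᴴ C_{μν})` (scalar, `0⁺⁺`). This file adds its
PSEUDOSCALAR companion (`0⁻⁺`, the clover topological charge density up to the factor `1/(8π²)`)

  `cloverPseudoscalar ρ x U = −2 Re tr(C₀₁C₂₃ − C₀₂C₁₃ + C₀₃C₁₂) = −¼ ε_{μνρσ} Re tr(C_{μν}C_{ρσ})`,

normalised so that `S ± P = ∑_{i} ‖C_{0i} ± C̃_{0i}‖² ≥ 0` is the self-dual/anti-self-dual split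
(Muzinich–Nair: `tr F² ≥ |tr F F̃|` pointwise [MuzinichNair1986]); `P` is odd and `S` even under
time reflections (Seiler–Stamatescu / Aguado–Seiler [AguadoSeiler2005, §1]).

## Contents (all definitions have bodies; everything stated is proved)

* `cloverLeafSum V x μ ν` — Lüscher's `Q_{μν}(x)`: the sum of the four plaquette loops ("leaves")
  of a matrix link field, so that `flowedClover ρ t U x μ ν = π_𝔤 (¼ Q_{μν})` (`flowedClover_eq`,
  `rfl`); `cloverEdges`, `cloverSiteEdges` (its 12 links; the union over planes);
  `cloverLeafSum_swap` (`Q_{νμ} = Q_{μν}ᴴ`), `cloverLeafSum_congr` (locality),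
  `cloverLeafSum_gaugeTransform` (`Q ↦ ρ(g_x) Q ρ(g_x)ᴴ`).
* Lie-projection lemmas for `H ⊆ U(N)`: `lieProjection_conjTranspose` (`π(Wᴴ) = −π(W)`:
  Hermitian ⊥ skew-Hermitian), `lieProjection_conj` (`Ad`-equivariance `π(P W Pᴴ) = P π(W) Pᴴ`);
  hence `flowedClover_swap` (`C_{νμ} = −C_{μν}`, any flow time), `flowedClover_zero_gaugeTransform`.
* `cloverPseudoscalar ρ x U` (sites `Fin 4 → R`, any `R`, exactly as `flowedClover`; definitionally
  the `let P` of route `DualityDefect`), gauge invariance and locality of `P_x` and of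
  `S_x = flowedCloverEnergy ρ 0 x` (general formula and the `ℤᵈ` predicates `IsZdGaugeInvariant`,
  `IsCylinder`).

Continuity, boundedness, measurability and the packaged `LocalGaugeObservable 4 G` (`YMSpecies`)
versions `cloverPseudoscalarObservable r`, `cloverEnergyObservable r` are in
`CloverObservables.lean`; parity under time reflections and the pointwise bound `|P| ≤ S` in
`CloverPseudoscalarParity.lean`.

## References

* M. Lüscher, JHEP 08 (2010) 071, arXiv:1006.4518, §3.2 and Fig. 1 (clover `G_{μν}`),
  eq. (2.1) (`E = ¼ GᵃGᵃ`). [Luscher2010]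
* I. J. Muzinich, V. P. Nair, Phys. Lett. B 178 (1986) 105, eqs. (5)–(10) (Cauchy–Schwarz for
  the `0⁺⁺`/`0⁻⁺` densities `φ = F_{μα}F_{να}`, `χ = F F̃`; `⟨F²F²⟩ ≥ ⟨FF̃ FF̃⟩`). [MuzinichNair1986]
* M. Aguado, E. Seiler, Phys. Rev. D 72 (2005) 094502, arXiv:hep-lat/0503015, §1 (reflection
  positivity forces `−⟨q(0)q(x)⟩ ≥ 0`, `q` odd under time reflection). [AguadoSeiler2005]
-/

noncomputable section

open scoped Matrix.Norms.Frobenius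
open Matrix

namespace Literature.MathematicalPhysics.QuantumLattice

attribute [local instance] frobeniusInnerProductSpace

/-! ### Two more facts about the projection `π_𝔤` onto the Lie algebra of `H ⊆ U(N)` -/

section LieProjection

variable {n : Type*} [Fintype n] [DecidableEq n]

omit [DecidableEq n] in
/-- Skew-Hermitian and Hermitian matrices are orthogonal for `Re tr(X† W)`. [folklore] -/
theorem re_trace_conjTranspose_mul_eq_zero {X W : Matrix n n ℂ} (hX : Xᴴ = -X) (hW : Wᴴ = W) :
    (Matrix.trace (Xᴴ * W)).re = 0 := by
  set s := Matrix.trace (Xᴴ * W) with hs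
  have h1 : Matrix.trace (X * W) = -s := by
    rw [hs, hX, Matrix.neg_mul, Matrix.trace_neg, neg_neg]
  have h2 : star s = -s := by
    rw [hs, ← Matrix.trace_conjTranspose, Matrix.conjTranspose_mul,
      Matrix.conjTranspose_conjTranspose, hW, Matrix.trace_mul_comm, h1]
  have h3 : s.re = (star s).re := (Complex.conj_re s).symm
  rw [h2, Complex.neg_re] at h3
  linarith

/-- Conjugation by elements of a submonoid `H` preserves its Lie algebra (the real span of the
one-parameter generators; no closedness needed): `P X Q ∈ 𝔤` for `X ∈ 𝔤`, `P, Q ∈ H`, `Q P = 1`.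
Hall, Thm. 3.20 (1). [cite: Hall2015, Theorem 3.20 (1)] -/
theorem conj_mem_matrixLieAlgebra_of_mul_mem {H : Set (Matrix n n ℂ)}
    (hmul : ∀ a ∈ H, ∀ b ∈ H, a * b ∈ H) {P Q X : Matrix n n ℂ} (hP : P ∈ H) (hQ : Q ∈ H)
    (hQP : Q * P = 1) (hX : X ∈ matrixLieAlgebra H) : P * X * Q ∈ matrixLieAlgebra H := by
  unfold matrixLieAlgebra at hX ⊢
  induction hX using Submodule.span_induction with
  | mem Y hY => exact Submodule.subset_span (conj_mem_oneParamGenerators hmul hP hQ hQP hY)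
  | zero => simp
  | add a b _ _ ha hb => simpa only [Matrix.mul_add, Matrix.add_mul] using add_mem ha hb
  | smul c a _ ha => simpa only [Matrix.mul_smul, Matrix.smul_mul] using Submodule.smul_mem _ c ha

/-- **`π_𝔤` of a reversed loop is minus `π_𝔤` of the loop**: for `H ⊆ U(N)` the Lie algebra is
skew-Hermitian, so `W + Wᴴ ⊥ 𝔤` and `π_𝔤(Wᴴ) = −π_𝔤(W)`. [folklore] -/
theorem lieProjection_conjTranspose {H : Set (Matrix n n ℂ)}
    (hU : H ⊆ (Matrix.unitaryGroup n ℂ : Set (Matrix n n ℂ))) (W : Matrix n n ℂ) :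
    lieProjection H Wᴴ = -lieProjection H W := by
  have hmem : W + Wᴴ ∈ (matrixLieAlgebra H)ᗮ := by
    rw [Submodule.mem_orthogonal]
    intro X hX
    have hXs : Xᴴ = -X := skewAdjoint.mem_iff.1 (matrixLieAlgebra_le_skewAdjoint hU hX)
    rw [frobenius_inner_def]
    exact re_trace_conjTranspose_mul_eq_zero hXs
      (by rw [conjTranspose_add, conjTranspose_conjTranspose, add_comm])
  have h0 : lieProjection H (W + Wᴴ) = 0 :=
    (Submodule.starProjection_apply_eq_zero_iff _).2 hmem
  rw [map_add] at h0
  exact eq_neg_of_add_eq_zero_right h0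

/-- **`Ad`-equivariance of `π_𝔤`**: for a submonoid `H ⊆ M_N(ℂ)` and a unitary `P ∈ H` with
`Pᴴ ∈ H`, `π_𝔤(P W Pᴴ) = P π_𝔤(W) Pᴴ` (conjugation by `P` is an isometry of `Re tr(X†Y)` preserving
`𝔤`, hence commutes with the orthogonal projection). [folklore] -/
theorem lieProjection_conj {H : Set (Matrix n n ℂ)} (hmul : ∀ a ∈ H, ∀ b ∈ H, a * b ∈ H)
    {P : Matrix n n ℂ} (hP : P ∈ H) (hPs : Pᴴ ∈ H) (hPu : P ∈ Matrix.unitaryGroup n ℂ)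
    (W : Matrix n n ℂ) :
    lieProjection H (P * W * Pᴴ) = P * lieProjection H W * Pᴴ := by
  have hPP : Pᴴ * P = 1 := Matrix.mem_unitaryGroup_iff'.1 hPu
  have hPP' : P * Pᴴ = 1 := Matrix.mem_unitaryGroup_iff.1 hPu
  refine Submodule.eq_starProjection_of_mem_orthogonal
    (conj_mem_matrixLieAlgebra_of_mul_mem hmul hP hPs hPP (lieProjection_mem H W)) ?_
  have hsub : P * W * Pᴴ - P * lieProjection H W * Pᴴ = P * (W - lieProjection H W) * Pᴴ := by
    rw [Matrix.mul_sub, Matrix.sub_mul]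
  rw [hsub, Submodule.mem_orthogonal]
  intro X hX
  have hX' : Pᴴ * X * P ∈ matrixLieAlgebra H :=
    conj_mem_matrixLieAlgebra_of_mul_mem hmul hPs hP hPP' hX
  have horth := (Submodule.mem_orthogonal _ _).1
    (Submodule.sub_starProjection_mem_orthogonal (K := matrixLieAlgebra H) W) _ hX'
  rw [frobenius_inner_def] at horth ⊢
  rw [conjTranspose_mul, conjTranspose_mul, conjTranspose_conjTranspose] at horth
  have hcyc : Matrix.trace (Xᴴ * (P * (W - lieProjection H W) * Pᴴ)) =
      Matrix.trace (Pᴴ * (Xᴴ * P) * (W - lieProjection H W)) := by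
    rw [show Xᴴ * (P * (W - lieProjection H W) * Pᴴ) = (Xᴴ * P * (W - lieProjection H W)) * Pᴴ by
      simp only [Matrix.mul_assoc], Matrix.trace_mul_comm]
    simp only [Matrix.mul_assoc]
  rw [hcyc]
  exact horth

end LieProjection

/-! ### The clover leaf sum `Q_{μν}(x)` of a matrix link field -/

section MatrixLevel

variable {d : ℕ} {R : Type*} {N : ℕ}

/-- **Lüscher's clover sum `Q_{μν}(x)`**: the sum of the four plaquette loops of the matrix link
field `V` in the `(μ, ν)`-plane through `x`, all with the orientation `μ → ν` and based at `x`
(reversed links enter through `†`); the clover field tensor is `π_𝔤(¼ Q_{μν}(x))` (Fig. 1: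
"anti-hermitian traceless part of the average of the four plaquette Wilson loops"). [cite: Luscher2010, §3.2 Fig. 1] -/
def cloverLeafSum [AddGroup R] [One R] (V : MatrixLinkField d R N) (x : Fin d → R) (μ ν : Fin d) :
    Matrix (Fin N) (Fin N) ℂ :=
  V (x, μ) * V (x + Pi.single μ 1, ν) * (V (x + Pi.single ν 1, μ))ᴴ * (V (x, ν))ᴴ +
    V (x, ν) * (V (x - Pi.single μ 1 + Pi.single ν 1, μ))ᴴ * (V (x - Pi.single μ 1, ν))ᴴ *
      V (x - Pi.single μ 1, μ) +
    (V (x - Pi.single μ 1, μ))ᴴ * (V (x - Pi.single μ 1 - Pi.single ν 1, ν))ᴴ *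
      V (x - Pi.single μ 1 - Pi.single ν 1, μ) * V (x - Pi.single ν 1, ν) +
    (V (x - Pi.single ν 1, ν))ᴴ * V (x - Pi.single ν 1, μ) * V (x - Pi.single ν 1 + Pi.single μ 1, ν) *
      (V (x, μ))ᴴ

/-- The twelve (positively oriented) links entering `Q_{μν}(x)`: the four leaves of the clover in
the `(μ, ν)`-plane through `x`. [cite: Luscher2010, §3.2 Fig. 1] -/
def cloverEdges [AddGroup R] [One R] [DecidableEq R] (x : Fin d → R) (μ ν : Fin d) :
    Finset ((Fin d → R) × Fin d) :=
  {(x, μ), (x + Pi.single μ 1, ν), (x + Pi.single ν 1, μ), (x, ν),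
    (x - Pi.single μ 1 + Pi.single ν 1, μ), (x - Pi.single μ 1, ν), (x - Pi.single μ 1, μ),
    (x - Pi.single μ 1 - Pi.single ν 1, ν), (x - Pi.single μ 1 - Pi.single ν 1, μ),
    (x - Pi.single ν 1, ν), (x - Pi.single ν 1, μ), (x - Pi.single ν 1 + Pi.single μ 1, ν)}

/-- The links of all clovers through `x` (union over the coordinate planes): the support of the
clover densities `S_x`, `P_x`. [folklore] -/
def cloverSiteEdges [AddGroup R] [One R] [DecidableEq R] (x : Fin d → R) :
    Finset ((Fin d → R) × Fin d) :=
  Finset.univ.biUnion fun p : Fin d × Fin d => cloverEdges x p.1 p.2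

/-- `cloverEdges x μ ν ⊆ cloverSiteEdges x`. [folklore] -/
theorem cloverEdges_subset_cloverSiteEdges [AddGroup R] [One R] [DecidableEq R] (x : Fin d → R)
    (μ ν : Fin d) : cloverEdges x μ ν ⊆ cloverSiteEdges x := by
  intro e he
  unfold cloverSiteEdges
  exact Finset.mem_biUnion.2 ⟨(μ, ν), Finset.mem_univ _, he⟩

/-- **Locality of `Q_{μν}(x)`**: it depends only on the links in `cloverEdges x μ ν`. [folklore] -/
theorem cloverLeafSum_congr [AddGroup R] [One R] [DecidableEq R] {V W : MatrixLinkField d R N}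
    {x : Fin d → R} {μ ν : Fin d} (h : ∀ e ∈ cloverEdges x μ ν, V e = W e) :
    cloverLeafSum V x μ ν = cloverLeafSum W x μ ν := by
  simp only [cloverEdges, Finset.forall_mem_insert, Finset.mem_singleton, forall_eq] at h
  obtain ⟨h1, h2, h3, h4, h5, h6, h7, h8, h9, h10, h11, h12⟩ := h
  rw [cloverLeafSum, cloverLeafSum, h1, h2, h3, h4, h5, h6, h7, h8, h9, h10, h11, h12]

/-- **`Q_{νμ}(x) = Q_{μν}(x)ᴴ`**: exchanging the axes reverses the orientation of the four loops. [folklore] -/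
theorem cloverLeafSum_swap [AddCommGroup R] [One R] (V : MatrixLinkField d R N) (x : Fin d → R)
    (μ ν : Fin d) : cloverLeafSum V x ν μ = (cloverLeafSum V x μ ν)ᴴ := by
  have hs : x - Pi.single ν (1 : R) - Pi.single μ 1 = x - Pi.single μ 1 - Pi.single ν 1 :=
    sub_right_comm _ _ _
  rw [cloverLeafSum, cloverLeafSum, hs]
  simp only [conjTranspose_add, conjTranspose_mul, conjTranspose_conjTranspose, Matrix.mul_assoc]
  abel

end MatrixLevel

/-! ### The clover at the group level: unfolding, antisymmetry, gauge covariance -/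

section GroupLevel

variable {d : ℕ} {R : Type*} {N : ℕ} {G : Type*} [Group G] (ρ : G →* Matrix (Fin N) (Fin N) ℂ)

/-- Unfolding of the tree's `flowedClover`: `C_{μν} = π_𝔤(¼ Q_{μν}(V_t))`. [cite: Luscher2010, §3.2 Fig. 1] -/
theorem flowedClover_eq [AddGroup R] [One R] (t : ℝ) (U : (Fin d → R) × Fin d → G) (x : Fin d → R)
    (μ ν : Fin d) :
    flowedClover ρ t U x μ ν =
      lieProjection (Set.range ρ) ((1 / 4 : ℝ) • cloverLeafSum (wilsonFlowMatrix ρ t U) x μ ν) :=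
  rfl

/-- At flow time `0` the clover is `π_𝔤(¼ Q_{μν})` of the bare link matrices `ρ(U)`. [cite: Luscher2010, §3.2 Fig. 1] -/
theorem flowedClover_zero [AddGroup R] [One R] (U : (Fin d → R) × Fin d → G) (x : Fin d → R)
    (μ ν : Fin d) :
    flowedClover ρ 0 U x μ ν =
      lieProjection (Set.range ρ) ((1 / 4 : ℝ) • cloverLeafSum (fun e => ρ (U e)) x μ ν) := by
  rw [flowedClover_eq, wilsonFlowMatrix_zero]

/-- The image of a unitary representation lies in `U(N)` (as a set). [folklore] -/
theorem range_subset_unitaryGroup (hρ : ∀ g, ρ g ∈ Matrix.unitaryGroup (Fin N) ℂ) :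
    Set.range ρ ⊆ (Matrix.unitaryGroup (Fin N) ℂ : Set (Matrix (Fin N) (Fin N) ℂ)) :=
  Set.range_subset_iff.2 hρ

/-- The image of a representation is closed under products. [folklore] -/
theorem mul_mem_range : ∀ a ∈ Set.range ρ, ∀ b ∈ Set.range ρ, a * b ∈ Set.range ρ := by
  rintro _ ⟨a, rfl⟩ _ ⟨b, rfl⟩
  exact ⟨a * b, map_mul ρ a b⟩

/-- **Antisymmetry of the clover field tensor**, `C_{νμ} = −C_{μν}` (any flow time), for a
unitary-valued `ρ`: `Q_{νμ} = Q_{μν}ᴴ` and `π_𝔤(Wᴴ) = −π_𝔤(W)`. [folklore] -/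
theorem flowedClover_swap [AddCommGroup R] [One R] (hρ : ∀ g, ρ g ∈ Matrix.unitaryGroup (Fin N) ℂ)
    (t : ℝ) (U : (Fin d → R) × Fin d → G) (x : Fin d → R) (μ ν : Fin d) :
    flowedClover ρ t U x ν μ = -flowedClover ρ t U x μ ν := by
  rw [flowedClover_eq, flowedClover_eq, cloverLeafSum_swap,
    ← lieProjection_conjTranspose (range_subset_unitaryGroup ρ hρ), conjTranspose_smul, star_trivial]

/-- The diagonal clovers vanish: `C_{μμ} = 0`. [folklore] -/
theorem flowedClover_self [AddCommGroup R] [One R] (hρ : ∀ g, ρ g ∈ Matrix.unitaryGroup (Fin N) ℂ)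
    (t : ℝ) (U : (Fin d → R) × Fin d → G) (x : Fin d → R) (μ : Fin d) :
    flowedClover ρ t U x μ μ = 0 := by
  have h := flowedClover_swap ρ hρ t U x μ μ
  have h2 : (2 : ℝ) • flowedClover ρ t U x μ μ = 0 := by rw [two_smul]; nth_rw 1 [h]; exact neg_add_cancel _
  exact (smul_eq_zero.1 h2).resolve_left two_ne_zero

/-- `Ad`-equivariance of `π_𝔤` along a unitary representation:
`π_𝔤(ρ(g) W ρ(g)ᴴ) = ρ(g) π_𝔤(W) ρ(g)ᴴ`. [folklore] -/
theorem lieProjection_range_conj (hρ : ∀ g, ρ g ∈ Matrix.unitaryGroup (Fin N) ℂ) (g : G)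
    (W : Matrix (Fin N) (Fin N) ℂ) :
    lieProjection (Set.range ρ) (ρ g * W * (ρ g)ᴴ) = ρ g * lieProjection (Set.range ρ) W * (ρ g)ᴴ :=
  lieProjection_conj (mul_mem_range ρ) ⟨g, rfl⟩
    (by rw [conjTranspose_map_of_mem_unitaryGroup ρ hρ]; exact ⟨g⁻¹, rfl⟩) (hρ g) W

/-- **Gauge covariance of the clover sum**: under `U(y,i) ↦ g(y) U(y,i) g(y+eᵢ)⁻¹` each leaf, hence
`Q_{μν}(x)`, is conjugated by `ρ(g(x))` (unitary `ρ`). [folklore] -/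
theorem cloverLeafSum_gaugeTransform [AddCommGroup R] [One R]
    (hρ : ∀ g, ρ g ∈ Matrix.unitaryGroup (Fin N) ℂ) (g : (Fin d → R) → G)
    (U : (Fin d → R) × Fin d → G) (x : Fin d → R) (μ ν : Fin d) :
    cloverLeafSum (fun e => ρ (g e.1 * U e * (g (e.1 + Pi.single e.2 1))⁻¹)) x μ ν =
      ρ (g x) * cloverLeafSum (fun e => ρ (U e)) x μ ν * (ρ (g x))ᴴ := by
  have hu : ∀ a : G, (ρ a)ᴴ * ρ a = 1 := fun a => Matrix.mem_unitaryGroup_iff'.1 (hρ a)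
  have hc : ∀ (a : G) (X : Matrix (Fin N) (Fin N) ℂ), (ρ a)ᴴ * (ρ a * X) = X := fun a X => by
    rw [← Matrix.mul_assoc, hu, Matrix.one_mul]
  set eμ : Fin d → R := Pi.single μ 1 with heμ
  set eν : Fin d → R := Pi.single ν 1 with heν
  have n1 : x - eμ + eν + eμ = x + eν := by abel
  have n2 : x - eμ + eμ = x := sub_add_cancel x eμ
  have n3 : x - eμ - eν + eν = x - eμ := sub_add_cancel _ _
  have n4 : x - eμ - eν + eμ = x - eν := by abel
  have n5 : x - eν + eν = x := sub_add_cancel _ _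
  have n6 : x - eν + eμ + eν = x + eμ := by abel
  have n7 : x + eν + eμ = x + eμ + eν := add_right_comm _ _ _
  simp only [cloverLeafSum, ← heμ, ← heν, n1, n2, n3, n4, n5, n6, n7, map_mul,
    ← conjTranspose_map_of_mem_unitaryGroup ρ hρ, conjTranspose_mul, conjTranspose_conjTranspose,
    Matrix.mul_assoc, hc, Matrix.mul_add, Matrix.add_mul]

/-- **Gauge covariance of the clover field tensor** (flow time `0`): `C_{μν}(x)` transforms as
`C ↦ ρ(g(x)) C ρ(g(x))ᴴ`. [folklore] -/
theorem flowedClover_zero_gaugeTransform [AddCommGroup R] [One R]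
    (hρ : ∀ g, ρ g ∈ Matrix.unitaryGroup (Fin N) ℂ) (g : (Fin d → R) → G)
    (U : (Fin d → R) × Fin d → G) (x : Fin d → R) (μ ν : Fin d) :
    flowedClover ρ 0 (fun e => g e.1 * U e * (g (e.1 + Pi.single e.2 1))⁻¹) x μ ν =
      ρ (g x) * flowedClover ρ 0 U x μ ν * (ρ (g x))ᴴ := by
  rw [flowedClover_zero, flowedClover_zero, cloverLeafSum_gaugeTransform ρ hρ,
    ← lieProjection_range_conj ρ hρ, Matrix.mul_smul, Matrix.smul_mul]

/-- Traces of conjugates: `tr(ρ(g) A ρ(g)ᴴ) = tr A` for unitary `ρ`. [folklore] -/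
theorem trace_conj_eq (hρ : ∀ g, ρ g ∈ Matrix.unitaryGroup (Fin N) ℂ) (g : G)
    (A : Matrix (Fin N) (Fin N) ℂ) : Matrix.trace (ρ g * A * (ρ g)ᴴ) = Matrix.trace A := by
  have hu : (ρ g)ᴴ * ρ g = 1 := Matrix.mem_unitaryGroup_iff'.1 (hρ g)
  rw [Matrix.trace_mul_cycle, hu, Matrix.one_mul]

/-- Products of conjugates: `(ρ(g) A ρ(g)ᴴ)(ρ(g) B ρ(g)ᴴ) = ρ(g) (A B) ρ(g)ᴴ` for unitary `ρ`. [folklore] -/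
theorem conj_mul_conj_eq (hρ : ∀ g, ρ g ∈ Matrix.unitaryGroup (Fin N) ℂ) (g : G)
    (A B : Matrix (Fin N) (Fin N) ℂ) :
    ρ g * A * (ρ g)ᴴ * (ρ g * B * (ρ g)ᴴ) = ρ g * (A * B) * (ρ g)ᴴ := by
  have hu : (ρ g)ᴴ * ρ g = 1 := Matrix.mem_unitaryGroup_iff'.1 (hρ g)
  simp only [Matrix.mul_assoc]
  rw [← Matrix.mul_assoc ((ρ g)ᴴ) (ρ g), hu, Matrix.one_mul]

/-- Adjoints of conjugates: `(ρ(g) A ρ(g)ᴴ)ᴴ = ρ(g) Aᴴ ρ(g)ᴴ`. [folklore] -/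
theorem conjTranspose_conj_eq (g : G) (A : Matrix (Fin N) (Fin N) ℂ) :
    (ρ g * A * (ρ g)ᴴ)ᴴ = ρ g * Aᴴ * (ρ g)ᴴ := by
  rw [conjTranspose_mul, conjTranspose_mul, conjTranspose_conjTranspose, Matrix.mul_assoc]

/-! ### The pseudoscalar density -/

/-- **The bare clover pseudoscalar density** at the site `x` of a `G`-gauge field on the lattice
with sites `Fin 4 → R` (`R = ℤ`: `ℤ⁴`, `LGConfig 4 G`; `R = ZMod L`: the torus):
`P_x(U) = −2 Re tr(C₀₁C₂₃ − C₀₂C₁₃ + C₀₃C₁₂)`, `C_{μν} = flowedClover ρ 0 U x μ ν` Lüscher's clover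
field tensor of the bare links. This is `−½ ∑_{μν} Re tr(C_{μν} C̃_{μν}) = −¼ ε_{μνρσ} Re tr(C_{μν}C_{ρσ})`
(`C̃₀₁ = C₂₃`, `C̃₀₂ = −C₁₃`, `C̃₀₃ = C₁₂`), i.e. `8π²` times the clover topological charge density,
normalised against the clover action density `S_x = flowedCloverEnergy ρ 0 x U = ∑_{μ<ν} ‖C_{μν}‖²`
so that `S ± P ≥ 0` is the (anti-)self-dual split and `|P| ≤ S`. The companion `0⁻⁺` density of
the `0⁺⁺` density `S` (Muzinich–Nair). [cite: MuzinichNair1986, eqs. (5)–(10)] -/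
def cloverPseudoscalar [AddGroup R] [One R] (x : Fin 4 → R) (U : (Fin 4 → R) × Fin 4 → G) : ℝ :=
  -2 * (flowedClover ρ 0 U x 0 1 * flowedClover ρ 0 U x 2 3 -
    flowedClover ρ 0 U x 0 2 * flowedClover ρ 0 U x 1 3 +
      flowedClover ρ 0 U x 0 3 * flowedClover ρ 0 U x 1 2).trace.re

/-- Unfolding of `cloverPseudoscalar` (the form inlined by route `DualityDefect`). [folklore] -/
theorem cloverPseudoscalar_def [AddGroup R] [One R] (x : Fin 4 → R) (U : (Fin 4 → R) × Fin 4 → G) :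
    cloverPseudoscalar ρ x U = -2 * (flowedClover ρ 0 U x 0 1 * flowedClover ρ 0 U x 2 3 -
      flowedClover ρ 0 U x 0 2 * flowedClover ρ 0 U x 1 3 +
        flowedClover ρ 0 U x 0 3 * flowedClover ρ 0 U x 1 2).trace.re :=
  rfl

/-- **Gauge invariance of `P_x`**: every clover is conjugated by `ρ(g(x))`, and the trace is
cyclic. [folklore] -/
theorem cloverPseudoscalar_gaugeTransform [AddCommGroup R] [One R]
    (hρ : ∀ g, ρ g ∈ Matrix.unitaryGroup (Fin N) ℂ) (g : (Fin 4 → R) → G)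
    (U : (Fin 4 → R) × Fin 4 → G) (x : Fin 4 → R) :
    cloverPseudoscalar ρ x (fun e => g e.1 * U e * (g (e.1 + Pi.single e.2 1))⁻¹) =
      cloverPseudoscalar ρ x U := by
  simp only [cloverPseudoscalar, flowedClover_zero_gaugeTransform ρ hρ, conj_mul_conj_eq ρ hρ,
    ← Matrix.mul_sub, ← Matrix.mul_add, ← Matrix.sub_mul, ← Matrix.add_mul, trace_conj_eq ρ hρ]

/-- **Gauge invariance of the clover action density `S_x`** (flow time `0`). [folklore] -/
theorem flowedCloverEnergy_zero_gaugeTransform [AddCommGroup R] [One R]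
    (hρ : ∀ g, ρ g ∈ Matrix.unitaryGroup (Fin N) ℂ) (g : (Fin d → R) → G)
    (U : (Fin d → R) × Fin d → G) (x : Fin d → R) :
    flowedCloverEnergy ρ 0 x (fun e => g e.1 * U e * (g (e.1 + Pi.single e.2 1))⁻¹) =
      flowedCloverEnergy ρ 0 x U := by
  unfold flowedCloverEnergy
  refine Finset.sum_congr rfl fun μ _ => Finset.sum_congr rfl fun ν _ => ?_
  split_ifs
  · rw [flowedClover_zero_gaugeTransform ρ hρ, conjTranspose_conj_eq, conj_mul_conj_eq ρ hρ,
      trace_conj_eq ρ hρ]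
  · rfl

/-! ### Locality, continuity, boundedness, measurability -/

/-- The bare clover depends only on the links of its four leaves. [folklore] -/
theorem flowedClover_zero_congr [AddGroup R] [One R] [DecidableEq R] {U V : (Fin d → R) × Fin d → G}
    {x : Fin d → R} {μ ν : Fin d} (h : ∀ e ∈ cloverEdges x μ ν, U e = V e) :
    flowedClover ρ 0 U x μ ν = flowedClover ρ 0 V x μ ν := by
  rw [flowedClover_zero, flowedClover_zero, cloverLeafSum_congr fun e he => by rw [h e he]]

/-- **Locality of `P_x`**: it depends only on the links of the clovers through `x`. [folklore] -/
theorem cloverPseudoscalar_congr [AddGroup R] [One R] [DecidableEq R] {U V : (Fin 4 → R) × Fin 4 → G}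
    {x : Fin 4 → R} (h : ∀ e ∈ cloverSiteEdges x, U e = V e) :
    cloverPseudoscalar ρ x U = cloverPseudoscalar ρ x V := by
  have hC : ∀ μ ν, flowedClover ρ 0 U x μ ν = flowedClover ρ 0 V x μ ν := fun μ ν =>
    flowedClover_zero_congr ρ fun e he => h e (cloverEdges_subset_cloverSiteEdges x μ ν he)
  simp only [cloverPseudoscalar, hC]

/-- **Locality of `S_x`** (flow time `0`). [folklore] -/
theorem flowedCloverEnergy_zero_congr [AddGroup R] [One R] [DecidableEq R]
    {U V : (Fin d → R) × Fin d → G} {x : Fin d → R} (h : ∀ e ∈ cloverSiteEdges x, U e = V e) :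
    flowedCloverEnergy ρ 0 x U = flowedCloverEnergy ρ 0 x V := by
  have hC : ∀ μ ν, flowedClover ρ 0 U x μ ν = flowedClover ρ 0 V x μ ν := fun μ ν =>
    flowedClover_zero_congr ρ fun e he => h e (cloverEdges_subset_cloverSiteEdges x μ ν he)
  simp only [flowedCloverEnergy, hC]

end GroupLevel

/-! ### The two clover densities as local gauge-invariant observables on `ℤ⁴` -/

section Observables

open Literature.MathematicalPhysics.QuantumFieldTheory (LatticeRep)
open Literature.Probability.LatticeModels (Site)

variable {N : ℕ} {G : Type*} [Group G] (ρ : G →* Matrix (Fin N) (Fin N) ℂ)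

/-- `P_x` is a cylinder function of the clover links at `x` (on `ℤ⁴`). [folklore] -/
theorem isCylinder_cloverPseudoscalar (x : Site 4) :
    IsCylinder (fun U : LGConfig 4 G => cloverPseudoscalar ρ x U) (cloverSiteEdges x) :=
  fun _ _ h => cloverPseudoscalar_congr ρ h

/-- `S_x` is a cylinder function of the clover links at `x` (on `ℤᵈ`). [folklore] -/
theorem isCylinder_flowedCloverEnergy_zero {d : ℕ} (x : Site d) :
    IsCylinder (fun U : LGConfig d G => flowedCloverEnergy ρ 0 x U) (cloverSiteEdges x) :=
  fun _ _ h => flowedCloverEnergy_zero_congr ρ h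

/-- `P_x` is invariant under lattice gauge transformations of `ℤ⁴` (unitary `ρ`). [folklore] -/
theorem isZdGaugeInvariant_cloverPseudoscalar (hρ : ∀ g, ρ g ∈ Matrix.unitaryGroup (Fin N) ℂ)
    (x : Site 4) : IsZdGaugeInvariant (fun U : LGConfig 4 G => cloverPseudoscalar ρ x U) :=
  fun g U => cloverPseudoscalar_gaugeTransform ρ hρ g U x

/-- `S_x` is invariant under lattice gauge transformations of `ℤᵈ` (unitary `ρ`). [folklore] -/
theorem isZdGaugeInvariant_flowedCloverEnergy_zero {d : ℕ}
    (hρ : ∀ g, ρ g ∈ Matrix.unitaryGroup (Fin N) ℂ) (x : Site d) :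
    IsZdGaugeInvariant (fun U : LGConfig d G => flowedCloverEnergy ρ 0 x U) :=
  fun g U => flowedCloverEnergy_zero_gaugeTransform ρ hρ g U x

end Observables

end Literature.MathematicalPhysics.QuantumLattice

end
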